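import Mathlib

/-!
# The class `η̄` of the branch knot is a (2,3)-product in the (2,3,7) triangle group

Solo-informed programme on `SmoothPoincare4`, session s36 (HKM24, arXiv:2402.11706, Question 1.4).
Let `G = π₁ Σ(2,3,7) = ⟨a, b ∣ a² = bab, a³ = b⁷⟩`, `h := a³` (central), `k := b⁻³ab⁻¹ab⁻³a`
(the class of the lifted branch knot `K̃ = Fix ι`), and `Δ(2,3,7) = G/⟨h⟩ = ⟨x, y ∣ x², y³, (xy)⁷⟩`
with `x = ba`, `y = a`, so `b = xy²`.  Under `a ↦ y`, `b ↦ xy²` (using `x⁻¹ = x`, `y⁻¹ = y²`) the word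
`k` becomes `W = y x y x y x y² x y² x y x y x y` and `b⁻¹a⁻¹b` becomes `V = y x y² x y²`.

`SoloInformed_etaBar_mul_isConj_x` : in ANY group with `x² = 1`, `y³ = 1` one has `W * V = C * x * C⁻¹` with the explicit
conjugator `C = y x y x y x y² x y²`.  Hence `η̄ = (C x C⁻¹) · (b⁻¹ a b)` is the product of an involution and an
element of order `3` in `Δ(2,3,7)` (indeed already in `ℤ/2 * ℤ/3 ≅ PSL(2,ℤ)`), so there is a homomorphism
`PSL(2,ℤ) → Δ(2,3,7)` carrying the image of the trefoil meridian to `η̄`; with `SoloInformed_sq_ba_eq_cube_a`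
(`(ba)² = a³` in `G`) it lifts to `π(T_{2,3}) = ⟨X, Y ∣ X² = Y³⟩ → G`, `X ↦ (ba)^{C̃}·h^{3r-1}`, `Y ↦ (a⁻¹)^{D̃}·h^{2r}`,
carrying the meridian to `k` — the explicit CEILING of the algebraic `U1`-filters (work/s36/dictionary.md §3):
the square knot `3₁ # 3₁*` admits `Γ₀ ↠ π(3₁) → G`, `μ ↦ k`, `λ ↦ 1` (`k` is a weight element of `G`,
cf. `SoloInformed_weightElement_prod_int_iff`).
-/

namespace Summit.SmoothPoincare4.SmoothPoincare4.Theorems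

/-- Core identity (any group, `x² = 1`, `y³ = 1`): the image `W` of `k = b⁻³ab⁻¹ab⁻³a` times the image `V` of
`b⁻¹a⁻¹b` is the conjugate of the involution `x` by `C = y x y x y x y² x y²`. -/
theorem SoloInformed_etaBar_mul_isConj_x {Gr : Type*} [Group Gr] (x y : Gr) (hx : x ^ 2 = 1) (hy : y ^ 3 = 1) :
    (y * x * y * x * y * x * y ^ 2 * x * y ^ 2 * x * y * x * y * x * y) * (y * x * y ^ 2 * x * y ^ 2)
      = (y * x * y * x * y * x * y ^ 2 * x * y ^ 2) * x * (y * x * y * x * y * x * y ^ 2 * x * y ^ 2)⁻¹ := by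
  have hxinv : x⁻¹ = x := inv_eq_of_mul_eq_one_right (by rw [← pow_two]; exact hx)
  have hy3 : y * y ^ 2 = 1 := by
    have : y * y ^ 2 = y ^ 3 := by group
    rw [this]; exact hy
  have hy3' : y ^ 2 * y = 1 := by
    have : y ^ 2 * y = y ^ 3 := by group
    rw [this]; exact hy
  have hyinv : y⁻¹ = y ^ 2 := inv_eq_of_mul_eq_one_right hy3
  have hy2inv : (y ^ 2)⁻¹ = y := inv_eq_of_mul_eq_one_right hy3'
  simp only [mul_inv_rev, hy2inv, hxinv, hyinv]
  simp only [pow_two, mul_assoc]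

/-- The involution statement: `W * V` squares to `1`. -/
theorem SoloInformed_etaBar_mul_sq_eq_one {Gr : Type*} [Group Gr] (x y : Gr) (hx : x ^ 2 = 1) (hy : y ^ 3 = 1) :
    ((y * x * y * x * y * x * y ^ 2 * x * y ^ 2 * x * y * x * y * x * y) * (y * x * y ^ 2 * x * y ^ 2)) ^ 2 = 1 := by
  rw [SoloInformed_etaBar_mul_isConj_x x y hx hy, pow_two]
  have hx' : x * x = 1 := by rw [← pow_two]; exact hx
  have key : ∀ c : Gr, c * x * c⁻¹ * (c * x * c⁻¹) = c * (x * x) * c⁻¹ := fun c => by group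
  rw [key, hx']
  group

/-- `η̄` itself is the product of the involution `C x C⁻¹` and the order-three element `V⁻¹ = b⁻¹ a b`
(`V⁻¹` is conjugate to `y`). -/
theorem SoloInformed_etaBar_eq_invol_mul_orderThree {Gr : Type*} [Group Gr] (x y : Gr) (hx : x ^ 2 = 1) (hy : y ^ 3 = 1) :
    (y * x * y * x * y * x * y ^ 2 * x * y ^ 2 * x * y * x * y * x * y)
      = ((y * x * y * x * y * x * y ^ 2 * x * y ^ 2) * x * (y * x * y * x * y * x * y ^ 2 * x * y ^ 2)⁻¹)
        * (y * x * y ^ 2 * x * y ^ 2)⁻¹ := by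
  rw [← SoloInformed_etaBar_mul_isConj_x x y hx hy]
  group

/-- The order-three factor is a conjugate of `y`: `(y x y² x y²)⁻¹ = (y x) * y * (y x)⁻¹` when `x² = 1`, `y³ = 1`
(it is the image of `b⁻¹ a b`). -/
theorem SoloInformed_orderThree_factor_isConj {Gr : Type*} [Group Gr] (x y : Gr) (hx : x ^ 2 = 1) (hy : y ^ 3 = 1) :
    (y * x * y ^ 2 * x * y ^ 2)⁻¹ = (y * x) * y * (y * x)⁻¹ := by
  have hxinv : x⁻¹ = x := inv_eq_of_mul_eq_one_right (by rw [← pow_two]; exact hx)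
  have hy3' : y ^ 2 * y = 1 := by
    have : y ^ 2 * y = y ^ 3 := by group
    rw [this]; exact hy
  have hy2inv : (y ^ 2)⁻¹ = y := inv_eq_of_mul_eq_one_right hy3'
  have hyinv : y⁻¹ = y ^ 2 := by
    apply inv_eq_of_mul_eq_one_right
    have : y * y ^ 2 = y ^ 3 := by group
    rw [this]; exact hy
  simp only [mul_inv_rev, hy2inv, hxinv, hyinv]
  simp only [pow_two, mul_assoc]

/-- The lift to `G = π₁Σ(2,3,7) = ⟨a, b ∣ a² = bab, a³ = b⁷⟩`: `(ba)² = a³` (`= h`), so `x̃ := ba`, `ỹ := a`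
satisfy the trefoil relation `x̃² = ỹ³`; this is what lifts `PSL(2,ℤ) → Δ(2,3,7)` to `π(T_{2,3}) → G`. -/
theorem SoloInformed_sq_ba_eq_cube_a {Gr : Type*} [Group Gr] (a b : Gr) (h1 : a ^ 2 = b * a * b) :
    (b * a) ^ 2 = a ^ 3 := by
  rw [pow_two]
  have : b * a * (b * a) = (b * a * b) * a := by group
  rw [this, ← h1]
  group

end Summit.SmoothPoincare4.SmoothPoincare4.Theorems
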